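import Summits.AtomisticToContinuum.HydrodynamicLimit.Theorems.InformationPercolationEngineChaosClosesEulerGaussianMoments
import HarnessLib

/-!
# The Enskog collisional-stress tensor identity `∫_{S²} (g·ω)₊² ω_k ω_l dω = (2π/15)(|g|² δ_{kl} + 2 g_k g_l)` (part B)

Helper for the line `Sketch` of the crux `InformationPercolationEngine.ChaosClosesEuler`
(stmt-AtomisticToContinuum-15141), waypoint `CollisionalPressureValueInBand` of `stub_fluxClosure`: the sphere
integral of the truncated collisional-transfer mark `|g·ω| ω⊗ω` against the hard-sphere flux `((w−v)·ω)₊` is the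
second-moment tensor computed here (Chapman–Cowling 1970 §16.4; Résibois–De Leener 1977 Ch. VI §3), whose isotropic
part produces the excess pressure `p_hs − ρθ`.

Proof without parametrising `S²` (continuing part A, `…ChaosClosesEulerGaussianMoments.lean`): the Gaussian-weighted
integral `∫_{ℝ³} (g·x)₊² x_k x_l e^{-|x|²/2} dx` equals the sphere integral times `∫₀^∞ r⁶ e^{-r²/2} dr = (15/2)√(2π)`
(polar coordinates, `measurePreserving_homeomorphUnitSphereProd`), and equals `½ ∫ (g·x)² x_k x_l e^{-|x|²/2} dx`
(even symmetrisation `a₊² + (−a)₊² = a²`), a Gaussian fourth moment evaluated by polarisation from the Isserlis form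
`∫ (g·x)²(h·x)² e^{-|x|²/2} dx = (2π)^{3/2}(|g|²|h|² + 2(g·h)²)`, reduced to part A's coordinate integrals by Householder maps.

References: S. Chapman, T. G. Cowling, *The Mathematical Theory of Non-uniform Gases*, 3rd ed. (1970), §16.4;
P. Résibois, M. De Leener, *Classical Kinetic Theory of Fluids*, Wiley (1977), Ch. VI §3.
-/

noncomputable section

namespace Summit.AtomisticToContinuum.HydrodynamicLimit.Theorems.ChaosClosesEulerEnskogTensor

open MeasureTheory Real Set Metric
open scoped InnerProductSpace ENNReal BigOperators
open Literature.MathematicalPhysics.KineticTheory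

/-! ## §5 Three Gaussian moments of projections -/

/-- `∫ ⟪g,x⟫⁴ e^{-|x|²/2} dx = 3 (2π)^{3/2} |g|⁴`. [folklore] -/
theorem integral_inner_pow_four (g : V3) :
    ∫ x : V3, ⟪g, x⟫_ℝ ^ 4 * rexp (-‖x‖ ^ 2 / 2) = 3 * √(2 * π) ^ 3 * ‖g‖ ^ 4 := by
  by_cases hg : g = 0
  · simp [hg]
  have hgn : ‖g‖ ≠ 0 := norm_ne_zero_iff.2 hg
  set a : V3 := ‖g‖⁻¹ • g with ha
  have han : ‖a‖ = 1 := by rw [ha, norm_smul, norm_inv, norm_norm, inv_mul_cancel₀ hgn]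
  have hga : g = ‖g‖ • a := by rw [ha, smul_smul, mul_inv_cancel₀ hgn, one_smul]
  obtain ⟨S, hS⟩ := exists_isometry_map_eq_single han
  have h := integral_comp_isometry S (fun p _ => p ^ 4) a 0
  rw [hS] at h
  simp only [inner_single_one_left] at h
  rw [integral_coord_pow_four] at h
  have hinner : ∀ x : V3, ⟪g, x⟫_ℝ = ‖g‖ * ⟪a, x⟫_ℝ := fun x => by
    conv_lhs => rw [hga]
    rw [real_inner_smul_left]
  calc ∫ x : V3, ⟪g, x⟫_ℝ ^ 4 * rexp (-‖x‖ ^ 2 / 2)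
      = ∫ x : V3, ‖g‖ ^ 4 * (⟪a, x⟫_ℝ ^ 4 * rexp (-‖x‖ ^ 2 / 2)) := by
        refine integral_congr_ae (Filter.Eventually.of_forall fun x => ?_)
        simp only
        rw [hinner]; ring
    _ = ‖g‖ ^ 4 * ∫ x : V3, ⟪a, x⟫_ℝ ^ 4 * rexp (-‖x‖ ^ 2 / 2) := integral_const_mul _ _
    _ = 3 * √(2 * π) ^ 3 * ‖g‖ ^ 4 := by rw [h]; ring

/-- For orthogonal `g ⊥ u`: `∫ ⟪g,x⟫³⟪u,x⟫ e^{-|x|²/2} dx = 0`. [folklore] -/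
theorem integral_inner_pow_three_mul_inner {g u : V3} (hgu : ⟪g, u⟫_ℝ = 0) :
    ∫ x : V3, ⟪g, x⟫_ℝ ^ 3 * ⟪u, x⟫_ℝ * rexp (-‖x‖ ^ 2 / 2) = 0 := by
  by_cases hg : g = 0
  · simp [hg]
  by_cases hu : u = 0
  · simp [hu]
  have hgn : ‖g‖ ≠ 0 := norm_ne_zero_iff.2 hg
  have hun : ‖u‖ ≠ 0 := norm_ne_zero_iff.2 hu
  set a : V3 := ‖g‖⁻¹ • g with ha
  set b : V3 := ‖u‖⁻¹ • u with hb
  have han : ‖a‖ = 1 := by rw [ha, norm_smul, norm_inv, norm_norm, inv_mul_cancel₀ hgn]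
  have hbn : ‖b‖ = 1 := by rw [hb, norm_smul, norm_inv, norm_norm, inv_mul_cancel₀ hun]
  have hab : ⟪a, b⟫_ℝ = 0 := by
    rw [ha, hb, inner_smul_left, inner_smul_right, hgu]; simp
  have hga : g = ‖g‖ • a := by rw [ha, smul_smul, mul_inv_cancel₀ hgn, one_smul]
  have hub : u = ‖u‖ • b := by rw [hb, smul_smul, mul_inv_cancel₀ hun, one_smul]
  obtain ⟨S, hSa, hSb⟩ := exists_isometry_map_pair han hbn hab
  have h := integral_comp_isometry S (fun p q => p ^ 3 * q) a b
  rw [hSa, hSb] at h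
  simp only [inner_single_one_left] at h
  rw [integral_coord_cube_one] at h
  have hinner : ∀ x : V3, ⟪g, x⟫_ℝ = ‖g‖ * ⟪a, x⟫_ℝ := fun x => by
    conv_lhs => rw [hga]
    rw [real_inner_smul_left]
  have hinner' : ∀ x : V3, ⟪u, x⟫_ℝ = ‖u‖ * ⟪b, x⟫_ℝ := fun x => by
    conv_lhs => rw [hub]
    rw [real_inner_smul_left]
  calc ∫ x : V3, ⟪g, x⟫_ℝ ^ 3 * ⟪u, x⟫_ℝ * rexp (-‖x‖ ^ 2 / 2)
      = ∫ x : V3, (‖g‖ ^ 3 * ‖u‖) * (⟪a, x⟫_ℝ ^ 3 * ⟪b, x⟫_ℝ * rexp (-‖x‖ ^ 2 / 2)) := by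
        refine integral_congr_ae (Filter.Eventually.of_forall fun x => ?_)
        simp only
        rw [hinner, hinner']; ring
    _ = (‖g‖ ^ 3 * ‖u‖) * ∫ x : V3, ⟪a, x⟫_ℝ ^ 3 * ⟪b, x⟫_ℝ * rexp (-‖x‖ ^ 2 / 2) :=
        integral_const_mul _ _
    _ = 0 := by rw [h]; ring

/-- For orthogonal `g ⊥ u`: `∫ ⟪g,x⟫²⟪u,x⟫² e^{-|x|²/2} dx = (2π)^{3/2}|g|²|u|²`. [folklore] -/
theorem integral_inner_sq_mul_inner_sq {g u : V3} (hgu : ⟪g, u⟫_ℝ = 0) :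
    ∫ x : V3, ⟪g, x⟫_ℝ ^ 2 * ⟪u, x⟫_ℝ ^ 2 * rexp (-‖x‖ ^ 2 / 2) = √(2 * π) ^ 3 * ‖g‖ ^ 2 * ‖u‖ ^ 2 := by
  by_cases hg : g = 0
  · simp [hg]
  by_cases hu : u = 0
  · simp [hu]
  have hgn : ‖g‖ ≠ 0 := norm_ne_zero_iff.2 hg
  have hun : ‖u‖ ≠ 0 := norm_ne_zero_iff.2 hu
  set a : V3 := ‖g‖⁻¹ • g with ha
  set b : V3 := ‖u‖⁻¹ • u with hb
  have han : ‖a‖ = 1 := by rw [ha, norm_smul, norm_inv, norm_norm, inv_mul_cancel₀ hgn]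
  have hbn : ‖b‖ = 1 := by rw [hb, norm_smul, norm_inv, norm_norm, inv_mul_cancel₀ hun]
  have hab : ⟪a, b⟫_ℝ = 0 := by
    rw [ha, hb, inner_smul_left, inner_smul_right, hgu]; simp
  have hga : g = ‖g‖ • a := by rw [ha, smul_smul, mul_inv_cancel₀ hgn, one_smul]
  have hub : u = ‖u‖ • b := by rw [hb, smul_smul, mul_inv_cancel₀ hun, one_smul]
  obtain ⟨S, hSa, hSb⟩ := exists_isometry_map_pair han hbn hab
  have h := integral_comp_isometry S (fun p q => p ^ 2 * q ^ 2) a b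
  rw [hSa, hSb] at h
  simp only [inner_single_one_left] at h
  rw [integral_coord_sq_sq] at h
  have hinner : ∀ x : V3, ⟪g, x⟫_ℝ = ‖g‖ * ⟪a, x⟫_ℝ := fun x => by
    conv_lhs => rw [hga]
    rw [real_inner_smul_left]
  have hinner' : ∀ x : V3, ⟪u, x⟫_ℝ = ‖u‖ * ⟪b, x⟫_ℝ := fun x => by
    conv_lhs => rw [hub]
    rw [real_inner_smul_left]
  calc ∫ x : V3, ⟪g, x⟫_ℝ ^ 2 * ⟪u, x⟫_ℝ ^ 2 * rexp (-‖x‖ ^ 2 / 2)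
      = ∫ x : V3, (‖g‖ ^ 2 * ‖u‖ ^ 2) * (⟪a, x⟫_ℝ ^ 2 * ⟪b, x⟫_ℝ ^ 2 * rexp (-‖x‖ ^ 2 / 2)) := by
        refine integral_congr_ae (Filter.Eventually.of_forall fun x => ?_)
        simp only
        rw [hinner, hinner']; ring
    _ = (‖g‖ ^ 2 * ‖u‖ ^ 2) * ∫ x : V3, ⟪a, x⟫_ℝ ^ 2 * ⟪b, x⟫_ℝ ^ 2 * rexp (-‖x‖ ^ 2 / 2) :=
        integral_const_mul _ _
    _ = √(2 * π) ^ 3 * ‖g‖ ^ 2 * ‖u‖ ^ 2 := by rw [h]; ring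

/-! ## §6 The quadratic Gaussian form `Φ(g,h) = ∫ ⟪g,x⟫²⟪h,x⟫² e^{-|x|²/2} = (2π)^{3/2}(|g|²|h|² + 2⟪g,h⟫²)` -/

/-- `|⟪g,x⟫| ≤ |g| |x|`-type bound for the Gaussian-weighted quartic integrands. [folklore] -/
theorem abs_inner_pow_le (g : V3) (x : V3) (n : ℕ) : |⟪g, x⟫_ℝ| ^ n ≤ (‖g‖ * ‖x‖) ^ n :=
  pow_le_pow_left₀ (abs_nonneg _) (abs_real_inner_le_norm g x) n

/-- Integrability of `⟪g,x⟫²⟪h,x⟫⟪k,x⟫ e^{-|x|²/2}` (quartic polynomial times Gaussian). [folklore] -/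
theorem integrable_inner_sq_mul_inner_mul_inner (g h k : V3) :
    Integrable (fun x : V3 => ⟪g, x⟫_ℝ ^ 2 * (⟪h, x⟫_ℝ * ⟪k, x⟫_ℝ) * rexp (-‖x‖ ^ 2 / 2)) := by
  refine integrable_of_le_poly_gaussian (by fun_prop) (C := ‖g‖ ^ 2 * (‖h‖ * ‖k‖)) fun x => ?_
  have h1 : |⟪g, x⟫_ℝ| ≤ ‖g‖ * ‖x‖ := abs_real_inner_le_norm g x
  have h2 : |⟪h, x⟫_ℝ| ≤ ‖h‖ * ‖x‖ := abs_real_inner_le_norm h x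
  have h3 : |⟪k, x⟫_ℝ| ≤ ‖k‖ * ‖x‖ := abs_real_inner_le_norm k x
  rw [abs_mul, abs_mul, abs_mul, abs_of_pos (Real.exp_pos _), abs_pow]
  have hx4 : ‖x‖ ^ 4 ≤ 1 + ‖x‖ ^ 4 := by linarith
  calc |⟪g, x⟫_ℝ| ^ 2 * (|⟪h, x⟫_ℝ| * |⟪k, x⟫_ℝ|) * rexp (-‖x‖ ^ 2 / 2)
      ≤ (‖g‖ * ‖x‖) ^ 2 * ((‖h‖ * ‖x‖) * (‖k‖ * ‖x‖)) * rexp (-‖x‖ ^ 2 / 2) := by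
        gcongr
    _ = ‖g‖ ^ 2 * (‖h‖ * ‖k‖) * (‖x‖ ^ 4 * rexp (-‖x‖ ^ 2 / 2)) := by ring
    _ ≤ ‖g‖ ^ 2 * (‖h‖ * ‖k‖) * ((1 + ‖x‖ ^ 4) * rexp (-‖x‖ ^ 2 / 2)) := by gcongr

/-- **The quartic Gaussian form.** `∫ ⟪g,x⟫²⟪h,x⟫² e^{-|x|²/2} dx = (2π)^{3/2}(|g|²|h|² + 2⟪g,h⟫²)` for all
`g, h ∈ ℝ³` (Isserlis). Decompose `h = a g + u` with `u ⊥ g` and use §5. [folklore] -/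
theorem integral_inner_sq_mul_inner_sq_eq (g h : V3) :
    ∫ x : V3, ⟪g, x⟫_ℝ ^ 2 * ⟪h, x⟫_ℝ ^ 2 * rexp (-‖x‖ ^ 2 / 2) =
      √(2 * π) ^ 3 * (‖g‖ ^ 2 * ‖h‖ ^ 2 + 2 * ⟪g, h⟫_ℝ ^ 2) := by
  set a : ℝ := ⟪g, h⟫_ℝ / ‖g‖ ^ 2 with ha
  set u : V3 := h - a • g with hu
  have hhu : h = a • g + u := by rw [hu]; abel
  have hag : a * ‖g‖ ^ 2 = ⟪g, h⟫_ℝ := by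
    by_cases hg : g = 0
    · simp [hg]
    · rw [ha, div_mul_cancel₀]
      exact pow_ne_zero 2 (norm_ne_zero_iff.2 hg)
  have hgu : ⟪g, u⟫_ℝ = 0 := by
    rw [hu, inner_sub_right, real_inner_smul_right, real_inner_self_eq_norm_sq]
    linarith
  -- Pythagoras
  have hnorm : ‖h‖ ^ 2 = a ^ 2 * ‖g‖ ^ 2 + ‖u‖ ^ 2 := by
    have hag' : ⟪a • g, u⟫_ℝ = 0 := by rw [real_inner_smul_left, hgu, mul_zero]
    rw [hhu, norm_add_sq_real, hag', norm_smul, Real.norm_eq_abs, mul_pow, sq_abs]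
    ring
  -- pointwise expansion
  have hexp : ∀ x : V3, ⟪g, x⟫_ℝ ^ 2 * ⟪h, x⟫_ℝ ^ 2 * rexp (-‖x‖ ^ 2 / 2) =
      a ^ 2 * (⟪g, x⟫_ℝ ^ 4 * rexp (-‖x‖ ^ 2 / 2)) +
      2 * a * (⟪g, x⟫_ℝ ^ 3 * ⟪u, x⟫_ℝ * rexp (-‖x‖ ^ 2 / 2)) +
      ⟪g, x⟫_ℝ ^ 2 * ⟪u, x⟫_ℝ ^ 2 * rexp (-‖x‖ ^ 2 / 2) := by
    intro x
    have : ⟪h, x⟫_ℝ = a * ⟪g, x⟫_ℝ + ⟪u, x⟫_ℝ := by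
      rw [hhu, inner_add_left, real_inner_smul_left]
    rw [this]; ring
  have hI1 : Integrable (fun x : V3 => ⟪g, x⟫_ℝ ^ 4 * rexp (-‖x‖ ^ 2 / 2)) := by
    have := integrable_inner_sq_mul_inner_mul_inner g g g
    refine this.congr (Filter.Eventually.of_forall fun x => ?_)
    simp only; ring
  have hI2 : Integrable (fun x : V3 => ⟪g, x⟫_ℝ ^ 3 * ⟪u, x⟫_ℝ * rexp (-‖x‖ ^ 2 / 2)) := by
    have := integrable_inner_sq_mul_inner_mul_inner g g u
    refine this.congr (Filter.Eventually.of_forall fun x => ?_)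
    simp only; ring
  have hI3 : Integrable (fun x : V3 => ⟪g, x⟫_ℝ ^ 2 * ⟪u, x⟫_ℝ ^ 2 * rexp (-‖x‖ ^ 2 / 2)) := by
    have := integrable_inner_sq_mul_inner_mul_inner g u u
    refine this.congr (Filter.Eventually.of_forall fun x => ?_)
    simp only; ring
  simp_rw [hexp]
  have hI12 : Integrable (fun x : V3 => a ^ 2 * (⟪g, x⟫_ℝ ^ 4 * rexp (-‖x‖ ^ 2 / 2)) +
      2 * a * (⟪g, x⟫_ℝ ^ 3 * ⟪u, x⟫_ℝ * rexp (-‖x‖ ^ 2 / 2))) :=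
    (hI1.const_mul _).add (hI2.const_mul _)
  rw [integral_add hI12 hI3, integral_add (hI1.const_mul _) (hI2.const_mul _), integral_const_mul,
    integral_const_mul, integral_inner_pow_four, integral_inner_pow_three_mul_inner hgu,
    integral_inner_sq_mul_inner_sq hgu]
  have hu2 : ‖u‖ ^ 2 = ‖h‖ ^ 2 - a ^ 2 * ‖g‖ ^ 2 := by linarith
  rw [hu2, ← hag]
  ring

/-! ## §7 Polarisation: the coordinate second moments `M_kl(g) = ∫ ⟪g,x⟫² x_k x_l e^{-|x|²/2}` -/

/-- `x_k x_l = ¼(⟪e_k+e_l, x⟫² − ⟪e_k−e_l, x⟫²)`. [folklore] -/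
theorem coord_mul_coord_eq (k l : Fin 3) (x : V3) :
    x.ofLp k * x.ofLp l =
      (⟪EuclideanSpace.single k (1:ℝ) + EuclideanSpace.single l 1, x⟫_ℝ ^ 2 -
        ⟪EuclideanSpace.single k (1:ℝ) - EuclideanSpace.single l 1, x⟫_ℝ ^ 2) / 4 := by
  rw [inner_add_left, inner_sub_left, inner_single_one_left, inner_single_one_left]
  ring

/-- `⟪e_k, e_l⟫ = δ_kl`. [folklore] -/
theorem inner_single_single (k l : Fin 3) :
    ⟪(EuclideanSpace.single k (1:ℝ) : V3), EuclideanSpace.single l 1⟫_ℝ = if k = l then 1 else 0 := by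
  rw [inner_single_one_left, PiLp.single_apply]
/-- `⟪x, e_i⟫ = x_i`. [folklore] -/
theorem inner_single_one_right (i : Fin 3) (x : V3) : ⟪x, EuclideanSpace.single i (1 : ℝ)⟫_ℝ = x.ofLp i := by
  rw [← real_inner_comm, inner_single_one_left]

/-- `‖e_k + e_l‖² = 2 + 2δ_kl`. [folklore] -/
theorem norm_sq_single_add_single (k l : Fin 3) :
    ‖(EuclideanSpace.single k (1:ℝ) + EuclideanSpace.single l 1 : V3)‖ ^ 2 =
      2 + 2 * (if k = l then 1 else 0) := by
  rw [norm_add_sq_real, inner_single_single]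
  split_ifs <;> simp <;> norm_num

/-- `‖e_k − e_l‖² = 2 − 2 δ_kl`. [folklore] -/
theorem norm_sq_single_sub_single (k l : Fin 3) :
    ‖(EuclideanSpace.single k (1:ℝ) - EuclideanSpace.single l 1 : V3)‖ ^ 2 =
      2 - 2 * (if k = l then 1 else 0) := by
  rw [norm_sub_sq_real, inner_single_single]
  split_ifs <;> simp <;> norm_num

/-- **Coordinate second moments of the Gaussian quartic.** `∫ ⟪g,x⟫² x_k x_l e^{-|x|²/2} dx =
(2π)^{3/2}(|g|² δ_kl + 2 g_k g_l)`. [folklore] -/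
theorem integral_inner_sq_mul_coord_mul_coord (g : V3) (k l : Fin 3) :
    ∫ x : V3, ⟪g, x⟫_ℝ ^ 2 * (x.ofLp k * x.ofLp l) * rexp (-‖x‖ ^ 2 / 2) =
      √(2 * π) ^ 3 * (‖g‖ ^ 2 * (if k = l then 1 else 0) + 2 * (g.ofLp k * g.ofLp l)) := by
  set ep : V3 := EuclideanSpace.single k (1:ℝ) + EuclideanSpace.single l 1 with hep
  set em : V3 := EuclideanSpace.single k (1:ℝ) - EuclideanSpace.single l 1 with hem
  have hpt : ∀ x : V3, ⟪g, x⟫_ℝ ^ 2 * (x.ofLp k * x.ofLp l) * rexp (-‖x‖ ^ 2 / 2) =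
      (1 / 4) * (⟪g, x⟫_ℝ ^ 2 * ⟪ep, x⟫_ℝ ^ 2 * rexp (-‖x‖ ^ 2 / 2)) -
      (1 / 4) * (⟪g, x⟫_ℝ ^ 2 * ⟪em, x⟫_ℝ ^ 2 * rexp (-‖x‖ ^ 2 / 2)) := by
    intro x; rw [coord_mul_coord_eq]; ring
  have hIp : Integrable (fun x : V3 => ⟪g, x⟫_ℝ ^ 2 * ⟪ep, x⟫_ℝ ^ 2 * rexp (-‖x‖ ^ 2 / 2)) := by
    have := integrable_inner_sq_mul_inner_mul_inner g ep ep
    refine this.congr (Filter.Eventually.of_forall fun x => ?_)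
    simp only; ring
  have hIm : Integrable (fun x : V3 => ⟪g, x⟫_ℝ ^ 2 * ⟪em, x⟫_ℝ ^ 2 * rexp (-‖x‖ ^ 2 / 2)) := by
    have := integrable_inner_sq_mul_inner_mul_inner g em em
    refine this.congr (Filter.Eventually.of_forall fun x => ?_)
    simp only; ring
  simp_rw [hpt]
  rw [integral_sub (hIp.const_mul _) (hIm.const_mul _), integral_const_mul, integral_const_mul,
    integral_inner_sq_mul_inner_sq_eq, integral_inner_sq_mul_inner_sq_eq, hep, hem,
    norm_sq_single_add_single, norm_sq_single_sub_single, inner_add_right, inner_sub_right,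
    inner_single_one_right, inner_single_one_right]
  ring

/-! ## §8 Even symmetrisation: the positive part costs a factor `½` -/

/-- `a₊² + (−a)₊² = a²`. [folklore] -/
theorem posPart_sq_add_negPart_sq (a : ℝ) : (max a 0) ^ 2 + (max (-a) 0) ^ 2 = a ^ 2 := by
  rcases le_total 0 a with h | h
  · simp [max_eq_left h, max_eq_right (neg_nonpos.2 h)]
  · simp [max_eq_right h, max_eq_left (neg_nonneg.2 h)]

/-- `|x_k| ≤ |x|` on `ℝ³`. [folklore] -/
theorem abs_coord_le_norm (x : V3) (k : Fin 3) : |x.ofLp k| ≤ ‖x‖ := by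
  have h : x.ofLp k ^ 2 ≤ ‖x‖ ^ 2 := by
    rw [EuclideanSpace.norm_sq_eq]
    simpa [Real.norm_eq_abs, sq_abs] using Finset.single_le_sum
      (f := fun j : Fin 3 => ‖x.ofLp j‖ ^ 2) (fun j _ => sq_nonneg _) (Finset.mem_univ k)
  exact abs_le.2 (abs_le_of_sq_le_sq' h (norm_nonneg _))

/-- Integrability of `(⟪g,x⟫)₊² x_k x_l e^{-|x|²/2}`. [folklore] -/
theorem integrable_posPart_sq_coord (g : V3) (k l : Fin 3) :
    Integrable (fun x : V3 => (max ⟪g, x⟫_ℝ 0) ^ 2 * (x.ofLp k * x.ofLp l) * rexp (-‖x‖ ^ 2 / 2)) := by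
  refine integrable_of_le_poly_gaussian (by fun_prop) (C := ‖g‖ ^ 2) fun x => ?_
  have h1 : |max ⟪g, x⟫_ℝ 0| ≤ ‖g‖ * ‖x‖ := by
    rw [abs_of_nonneg (le_max_right _ _)]
    exact max_le ((le_abs_self _).trans (abs_real_inner_le_norm g x)) (by positivity)
  have hk : |x.ofLp k| ≤ ‖x‖ := abs_coord_le_norm x k
  have hl : |x.ofLp l| ≤ ‖x‖ := abs_coord_le_norm x l
  rw [abs_mul, abs_mul, abs_mul, abs_of_pos (Real.exp_pos _), abs_pow]
  calc |max ⟪g, x⟫_ℝ 0| ^ 2 * (|x.ofLp k| * |x.ofLp l|) * rexp (-‖x‖ ^ 2 / 2)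
      ≤ (‖g‖ * ‖x‖) ^ 2 * (‖x‖ * ‖x‖) * rexp (-‖x‖ ^ 2 / 2) := by gcongr
    _ = ‖g‖ ^ 2 * (‖x‖ ^ 4 * rexp (-‖x‖ ^ 2 / 2)) := by ring
    _ ≤ ‖g‖ ^ 2 * ((1 + ‖x‖ ^ 4) * rexp (-‖x‖ ^ 2 / 2)) := by gcongr; linarith [sq_nonneg (‖x‖ ^ 2)]

/-- **Even symmetrisation.** `∫ (⟪g,x⟫)₊² x_k x_l e^{-|x|²/2} dx = ½ ∫ ⟪g,x⟫² x_k x_l e^{-|x|²/2} dx`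
(the substitution `x ↦ −x` exchanges `a₊` and `(−a)₊`). [folklore] -/
theorem integral_posPart_sq_coord (g : V3) (k l : Fin 3) :
    ∫ x : V3, (max ⟪g, x⟫_ℝ 0) ^ 2 * (x.ofLp k * x.ofLp l) * rexp (-‖x‖ ^ 2 / 2) =
      (1 / 2) * (√(2 * π) ^ 3 * (‖g‖ ^ 2 * (if k = l then 1 else 0) + 2 * (g.ofLp k * g.ofLp l))) := by
  have hneg := integral_neg_eq_self
    (fun x : V3 => (max ⟪g, x⟫_ℝ 0) ^ 2 * (x.ofLp k * x.ofLp l) * rexp (-‖x‖ ^ 2 / 2)) volume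
  simp only [inner_neg_right, norm_neg, WithLp.ofLp_neg, Pi.neg_apply, neg_mul_neg] at hneg
  -- `hneg : ∫ (max (-⟪g,x⟫) 0)² x_k x_l w = ∫ (max ⟪g,x⟫ 0)² x_k x_l w`
  have hIneg : Integrable (fun x : V3 => (max (-⟪g, x⟫_ℝ) 0) ^ 2 * (x.ofLp k * x.ofLp l) * rexp (-‖x‖ ^ 2 / 2)) := by
    have := integrable_posPart_sq_coord (-g) k l
    refine this.congr (Filter.Eventually.of_forall fun x => ?_)
    simp only [inner_neg_left]
  have hsum : (∫ x : V3, (max ⟪g, x⟫_ℝ 0) ^ 2 * (x.ofLp k * x.ofLp l) * rexp (-‖x‖ ^ 2 / 2)) +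
      (∫ x : V3, (max (-⟪g, x⟫_ℝ) 0) ^ 2 * (x.ofLp k * x.ofLp l) * rexp (-‖x‖ ^ 2 / 2)) =
      √(2 * π) ^ 3 * (‖g‖ ^ 2 * (if k = l then 1 else 0) + 2 * (g.ofLp k * g.ofLp l)) := by
    rw [← integral_add (integrable_posPart_sq_coord g k l) hIneg, ← integral_inner_sq_mul_coord_mul_coord g k l]
    refine integral_congr_ae (Filter.Eventually.of_forall fun x => ?_)
    simp only
    rw [← posPart_sq_add_negPart_sq ⟪g, x⟫_ℝ]; ring
  rw [hneg] at hsum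
  linarith

/-! ## §9 Polar coordinates -/

/-- **Polar coordinates**: `∫_{ℝ³} (g·x)₊² x_k x_l e^{-|x|²/2} dx = [∫_{S²} (g·ω)₊² ω_k ω_l dω] · ∫₀^∞ r⁶ e^{-r²/2} dr`
(Mathlib's `measurePreserving_homeomorphUnitSphereProd`). [folklore] -/
theorem integral_posPart_sq_coord_polar (g : V3) (k l : Fin 3) :
    ∫ x : V3, (max ⟪g, x⟫_ℝ 0) ^ 2 * (x.ofLp k * x.ofLp l) * rexp (-‖x‖ ^ 2 / 2) =
      (∫ ω : sphere (0 : V3) 1, (max ⟪g, (ω : V3)⟫_ℝ 0) ^ 2 * ((ω : V3).ofLp k * (ω : V3).ofLp l)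
        ∂sphereMeasure) * ∫ r in Ioi (0 : ℝ), r ^ 6 * rexp (-r ^ 2 / 2) := by
  set f : V3 → ℝ := fun x => (max ⟪g, x⟫_ℝ 0) ^ 2 * (x.ofLp k * x.ofLp l) * rexp (-‖x‖ ^ 2 / 2) with hf
  set F : sphere (0 : V3) 1 × Ioi (0 : ℝ) → ℝ :=
    fun p => (max ⟪g, (p.1 : V3)⟫_ℝ 0) ^ 2 * ((p.1 : V3).ofLp k * (p.1 : V3).ofLp l) *
      ((p.2 : ℝ) ^ 4 * rexp (-(p.2 : ℝ) ^ 2 / 2)) with hF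
  have hdim : Module.finrank ℝ V3 - 1 = 2 := by
    rw [show Module.finrank ℝ V3 = 3 from finrank_euclideanSpace_fin]
  have hmp := (volume : Measure V3).measurePreserving_homeomorphUnitSphereProd
  rw [hdim] at hmp
  have h1 : ∫ x, f x = ∫ x : ({(0 : V3)}ᶜ : Set V3), f x ∂(Measure.comap Subtype.val volume) := by
    rw [integral_subtype_comap (measurableSet_singleton _).compl f, restrict_compl_singleton]
  have h2 : ∀ x : ({(0 : V3)}ᶜ : Set V3), f x = F (homeomorphUnitSphereProd V3 x) := by
    intro x
    have hx : (x : V3) ≠ 0 := x.2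
    have hn : ‖(x : V3)‖ ≠ 0 := norm_ne_zero_iff.2 hx
    have hnpos : 0 < ‖(x : V3)‖ := norm_pos_iff.2 hx
    simp only [hf, hF, homeomorphUnitSphereProd_apply_fst_coe, homeomorphUnitSphereProd_apply_snd_coe,
      inner_smul_right, WithLp.ofLp_smul, Pi.smul_apply, smul_eq_mul]
    rw [max_mul_zero_of_nonneg (inv_nonneg.2 (norm_nonneg _))]
    field_simp
  have h3 : ∫ x : ({(0 : V3)}ᶜ : Set V3), F (homeomorphUnitSphereProd V3 x) ∂(Measure.comap Subtype.val volume)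
      = ∫ p, F p ∂((volume : Measure V3).toSphere.prod (Measure.volumeIoiPow 2)) :=
    hmp.integral_comp (Homeomorph.measurableEmbedding _) F
  have h4 : ∫ p, F p ∂((volume : Measure V3).toSphere.prod (Measure.volumeIoiPow 2))
      = (∫ ω, (max ⟪g, ((ω : sphere (0 : V3) 1) : V3)⟫_ℝ 0) ^ 2 *
          (((ω : sphere (0 : V3) 1) : V3).ofLp k * ((ω : sphere (0:V3) 1) : V3).ofLp l)
          ∂(volume : Measure V3).toSphere) *
        ∫ r, ((r : Ioi (0 : ℝ)) : ℝ) ^ 4 * rexp (-((r : Ioi (0 : ℝ)) : ℝ) ^ 2 / 2) ∂(Measure.volumeIoiPow 2) :=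
    integral_prod_mul (μ := (volume : Measure V3).toSphere) (ν := Measure.volumeIoiPow 2)
      (fun ω : sphere (0 : V3) 1 => (max ⟪g, (ω : V3)⟫_ℝ 0) ^ 2 * ((ω : V3).ofLp k * (ω : V3).ofLp l))
      (fun r : Ioi (0 : ℝ) => (r : ℝ) ^ 4 * rexp (-(r : ℝ) ^ 2 / 2))
  have h5 : ∫ r, ((r : Ioi (0 : ℝ)) : ℝ) ^ 4 * rexp (-((r : Ioi (0 : ℝ)) : ℝ) ^ 2 / 2) ∂(Measure.volumeIoiPow 2)
      = ∫ r in Ioi (0 : ℝ), r ^ 6 * rexp (-r ^ 2 / 2) := by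
    simp only [Measure.volumeIoiPow, ENNReal.ofReal]
    rw [integral_withDensity_eq_integral_smul (measurable_subtype_coe.pow_const _).real_toNNReal,
      integral_subtype_comap measurableSet_Ioi
        (fun a : ℝ => Real.toNNReal (a ^ 2) • (a ^ 4 * rexp (-a ^ 2 / 2)))]
    refine setIntegral_congr_fun measurableSet_Ioi fun x hx => ?_
    rw [NNReal.smul_def, Real.coe_toNNReal _ (pow_nonneg hx.out.le _), smul_eq_mul]
    ring
  rw [h1, integral_congr_ae (Filter.Eventually.of_forall h2), h3, h4, h5]
  rfl

/-! ## §10 The identity -/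

/-- **The Enskog collisional-stress tensor identity** (Chapman–Cowling 1970 §16.4; Résibois–De Leener 1977 Ch. VI §3):
`∫_{S²} (g·ω)₊² ω_k ω_l dσ(ω) = (2π/15)(|g|² δ_kl + 2 g_k g_l)` for all `g ∈ ℝ³`, `k, l`. [cite: ChapmanCowling1970, §16.4] -/
theorem integral_posPart_inner_sq_mul_coord_mul_coord (g : V3) (k l : Fin 3) :
    ∫ ω : sphere (0 : V3) 1, (max ⟪g, (ω : V3)⟫_ℝ 0) ^ 2 * ((ω : V3).ofLp k * (ω : V3).ofLp l) ∂sphereMeasure =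
      2 * Real.pi / 15 * (‖g‖ ^ 2 * (if k = l then 1 else 0) + 2 * (g.ofLp k * g.ofLp l)) := by
  have hpol := integral_posPart_sq_coord_polar g k l
  rw [integral_posPart_sq_coord, integral_Ioi_pow_six_mul_exp] at hpol
  set T := ∫ ω : sphere (0 : V3) 1, (max ⟪g, (ω : V3)⟫_ℝ 0) ^ 2 * ((ω : V3).ofLp k * (ω : V3).ofLp l)
    ∂sphereMeasure with hT
  have hs : 0 < √(2 * π) := Real.sqrt_pos.2 (by positivity)
  have hs2 : √(2 * π) ^ 2 = 2 * π := Real.sq_sqrt (by positivity)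
  -- `hpol : ½ s³ A = T · (15 s / 2)`; solve for `T`
  have hsne : √(2 * π) ≠ 0 := hs.ne'
  have key : T = (1 / 15) * √(2 * π) ^ 2 *
      (‖g‖ ^ 2 * (if k = l then 1 else 0) + 2 * (g.ofLp k * g.ofLp l)) := by
    field_simp at hpol
    field_simp
    nlinarith [hpol, hs]
  rw [key, hs2]; ring

/-- REGISTERED SUB-GOAL `stub_enskogTensorIdentity` of the line `Sketch`: the identity above. [cite: ChapmanCowling1970, §16.4] -/
theorem stub_enskogTensorIdentity :
    ∀ (g : V3) (k l : Fin 3),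
      ∫ ω : Metric.sphere (0 : V3) 1, (max ⟪g, (ω : V3)⟫_ℝ 0) ^ 2 * ((ω : V3) k * (ω : V3) l) ∂sphereMeasure =
        2 * Real.pi / 15 * (‖g‖ ^ 2 * (if k = l then 1 else 0) + 2 * (g k * g l)) :=
  fun g k l => integral_posPart_inner_sq_mul_coord_mul_coord g k l

end Summit.AtomisticToContinuum.HydrodynamicLimit.Theorems.ChaosClosesEulerEnskogTensor

end
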